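import Summits.AnomalousDissipation.AnomalousDissipation.Theorems.MomentParityQuarticGateKernel

/-!
# Order-3 surgery for `MomentParity.QuarticGate` (stmt-AnomalousDissipation-11464), line
# `axis-sectors`, stub `stub_order3SurgerySym` (S5b), helper I: the Casimir-free kernel step

The shifted, inflated moment sequence `y_Λ = (1, M₁, M₂, M₃ + S, Λ·M₄)` of the order-3 surgery
(`exists_shifted_sequence` of `…MomentParityQuarticGateKernel`, line `recession-cone`) with its
three Casimir hypotheses (vanishing ENERGY row, vanishing HELICITY row, QuadRigidity at level `N`)
replaced by the single hypothesis the kernel step actually consumes: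

* `hCas` : the `μ₀`-row of EVERY homogeneous quadratic Casimir over the basis `b` vanishes,
  `∀ P, P.IsHomogeneous 2 → (∀ u, IsLevel N u → ⟨B(u), ∇P(u)⟩ = 0) → ∫ ⟨F(u), ∇P(u)⟩ dμ₀ = 0`.

Everything else is verbatim `exists_shifted_sequence`; only the kernel step `hkerH` changes: for a
coefficient vector `p ⊥ range(c)` the quadratic `P = Σ p_α x^α` has a row polynomial `Q` with no
cubic part, so `P` is a Casimir on level-`N` fields, and
`L_{y₁}(Q) = L_{y₀}(Q) = ∫ Q dμ₀ = ∫ ⟨F(u), ∇P(u)⟩ dμ₀ = 0` by `hCas` directly.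
-/

-- `Summit.<Summit>.<Problem>` is the tree's mandated summit-side namespace (CONVENTIONS §2); for this
-- single-conjunct summit the two coincide, so the duplicate is deliberate.
set_option linter.dupNamespace false

namespace Summit.AnomalousDissipation.AnomalousDissipation.Theorems.MomentParityQuarticGate

open scoped BigOperators InnerProductSpace RealInnerProductSpace ENNReal
open MeasureTheory MvPolynomial Literature.MeasureTheory.Moments
open Literature.Analysis.FunctionSpaces Literature.Analysis.FluidPDE
open Summit.AnomalousDissipation.AnomalousDissipation.Theorems.QuarticGate.Negative

/-- **The target sequence of the order-3 surgery, Casimir-free form.** Data: a family `b` of band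
tests whose coordinate map `u ↦ ((u, bᵢ))ᵢ` is onto `ℝⁿ` from level-`N` fields and whose finite
combinations are band tests; a smooth force; a level-`N` law `μ₀` with bounded support and
nondegenerate covariance whose row vanishes on every homogeneous quadratic CASIMIR over `b`
(`hCas`); and, for every polynomial test over `b`, a row polynomial with the correct cubic top.
Conclusion: sequences `y₀` (the coordinate moments of `μ₀`) and `y_Λ` with `y_Λ 0 = 1`, `L_{y_Λ}`
strictly positive in degree `4`, `y_Λ = y₀` up to degree `2`, and `L_{y_Λ}(Q) = 0` for every
polynomial `Q` of degree `≤ 3` that computes the row of a homogeneous QUADRATIC test over `b` on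
level-`N` fields. [folklore] -/
-- adapted from …Theorems/MomentParityQuarticGateKernel.lean (`exists_shifted_sequence`): only the
-- kernel step `hkerH` differs.
theorem exists_shifted_sequence_of_casimirRows :
    ∀ {N n : ℕ} {b : Fin n → UnitAddTorus (Fin 3) → EuclideanSpace ℝ (Fin 3)}, (∀ i, IsBandTest N (b
      i)) → (∀ ξ : Fin n → ℝ, IsBandTest N (fun x => ∑ i, ξ i • b i x)) → (∀ (u : Torus.energySpace
      (Fin 3)) (ξ : Fin n → ℝ), Torus.pairing u.1 (fun x => ∑ i, ξ i • b i x) = ∑ i, ξ i *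
      Torus.pairing u.1 (b i)) → (∀ x : Fin n → ℝ, ∃ u : Torus.energySpace (Fin 3), IsLevel N u ∧
      (fun i => Torus.pairing u.1 (b i)) = x) → ∀ (ν : ℝ) {f : UnitAddTorus (Fin 3) → EuclideanSpace
      ℝ (Fin 3)}, Torus.IsSmooth f → ∀ (μ₀ : Measure (Torus.energySpace (Fin 3)))
      [IsProbabilityMeasure μ₀], (∀ᵐ u ∂μ₀, IsLevel N u) → (∃ R : ℝ, ∀ᵐ u ∂μ₀, ‖u‖ ≤ R) → (∀ g :
      UnitAddTorus (Fin 3) → EuclideanSpace ℝ (Fin 3), IsBandTest N g → (∃ u : Torus.energySpace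
      (Fin 3), IsLevel N u ∧ Torus.pairing u.1 g ≠ 0) → (∫ u, Torus.pairing u.1 g ∂μ₀) ^ 2 < ∫ u,
      (Torus.pairing u.1 g) ^ 2 ∂μ₀) →
      (∀ P : MvPolynomial (Fin n) ℝ, P.IsHomogeneous 2 →
        (∀ u : Torus.energySpace (Fin 3), IsLevel N u →
          Torus.nsGeneratorPairing (d := Fin 3) 0 0 u (polyGrad b P u) = 0) →
        ∫ u, Torus.nsGeneratorPairing ν f u (polyGrad b P u) ∂μ₀ = 0) →
      (∀ (P : MvPolynomial (Fin n) ℝ) (d : ℕ),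
      P.totalDegree ≤ d → ∃ Q : MvPolynomial (Fin n) ℝ, Q.totalDegree ≤ d + 1 ∧ (∀ u :
      Torus.energySpace (Fin 3), IsLevel N u → Torus.nsGeneratorPairing ν f u (polyGrad b P u) =
      MvPolynomial.eval (fun i => Torus.pairing u.1 (b i)) Q) ∧ (∀ u : Torus.energySpace (Fin 3),
      IsLevel N u → MvPolynomial.eval (fun i => Torus.pairing u.1 (b i))
      (MvPolynomial.homogeneousComponent (d + 1) Q) = Torus.nsGeneratorPairing (d := Fin 3) 0 0 u
      (polyGrad b (MvPolynomial.homogeneousComponent d P) u))) → ∃ y₀ y : (Fin n →₀ ℕ) → ℝ, (∀ Q :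
      MvPolynomial (Fin n) ℝ, Integrable (fun u : Torus.energySpace (Fin 3) => MvPolynomial.eval
      (fun i => Torus.pairing u.1 (b i)) Q) μ₀ ∧ ∫ u, MvPolynomial.eval (fun i => Torus.pairing u.1
      (b i)) Q ∂μ₀ = Literature.MeasureTheory.Moments.rieszFunctional y₀ Q) ∧ y 0 = 1 ∧
      Literature.MeasureTheory.Moments.IsStrictlyKPositive (Set.univ : Set (Fin n → ℝ)) 4 y ∧ (∀ α :
      Fin n →₀ ℕ, α.degree ≤ 2 → y α = y₀ α) ∧ ∀ P : MvPolynomial (Fin n) ℝ, P.IsHomogeneous 2 → ∀ Q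
      : MvPolynomial (Fin n) ℝ, Q.totalDegree ≤ 3 → (∀ u : Torus.energySpace (Fin 3), IsLevel N u →
      Torus.nsGeneratorPairing ν f u (polyGrad b P u) = MvPolynomial.eval (fun i => Torus.pairing
      u.1 (b i)) Q) → Literature.MeasureTheory.Moments.rieszFunctional y Q = 0 := by
  intro N n b hb hsumband hlin hlev ν f hf μ₀ _ hl₀ hbdd hnd hCas hRow
  classical
  -- (0) coordinate moments of `μ₀`
  obtain ⟨R, hR⟩ := hbdd
  have hb2 : ∀ i, MemLp (b i) 2 volume := fun i => (hb i).1.memLp 2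
  have hbs : ∀ i, Torus.IsSmooth (b i) := fun i => (hb i).1
  set y₀ : (Fin n →₀ ℕ) → ℝ := fun α => ∫ u, ∏ i, (Torus.pairing u.1 (b i)) ^ α i ∂μ₀ with hy₀
  have hmom : ∀ Q : MvPolynomial (Fin n) ℝ,
      Integrable (fun u : Torus.energySpace (Fin 3) => eval (fun i => Torus.pairing u.1 (b i)) Q) μ₀ ∧
      ∫ u, eval (fun i => Torus.pairing u.1 (b i)) Q ∂μ₀ = rieszFunctional y₀ Q := fun Q =>
    ⟨integrable_eval_coords hb2 μ₀ hR Q, integral_eval_coords_eq_rieszFunctional hb2 μ₀ hR Q⟩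
  have hy₀0 : y₀ 0 = 1 := by simp [hy₀]
  -- (1) fatten
  have hpd := rieszFunctional_lt_of_nondegenerate μ₀ y₀ (fun Q => (hmom Q).2) hsumband hlin hlev hnd
  obtain ⟨y₁, hy₁pos, hy₁eq⟩ := exists_isStrictlyKPositive_eq_of_degree_le_two n y₀ hy₀0 hpd
  -- (2) exponents of degree 2 and 3, row polynomials of the quadratic monomials
  obtain ⟨T₂, hT₂⟩ := exists_finset_degree_eq n 2
  obtain ⟨T₃, hT₃⟩ := exists_finset_degree_eq n 3
  have hQα : ∀ α : ↥T₂, ∃ Q : MvPolynomial (Fin n) ℝ, Q.totalDegree ≤ 3 ∧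
      (∀ u : Torus.energySpace (Fin 3), IsLevel N u →
        Torus.nsGeneratorPairing ν f u (polyGrad b (monomial α.1 (1 : ℝ)) u) =
          eval (fun i => Torus.pairing u.1 (b i)) Q) ∧
      (∀ u : Torus.energySpace (Fin 3), IsLevel N u →
        eval (fun i => Torus.pairing u.1 (b i)) (homogeneousComponent 3 Q) =
          Torus.nsGeneratorPairing (d := Fin 3) 0 0 u (polyGrad b (monomial α.1 (1 : ℝ)) u)) := by
    intro α
    obtain ⟨Q, h1, h2, h3⟩ := hRow (monomial α.1 1) 2
      ((totalDegree_monomial_le _ _).trans ((finsupp_degree_eq_sum α.1).symm.trans_le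
        ((hT₂ α.1).mp α.2).le))
    refine ⟨Q, h1, h2, fun u hu => ?_⟩
    rw [h3 u hu, homogeneousComponent_eq_self (isHomogeneous_monomial _ ((hT₂ α.1).mp α.2))]
  choose Qb hQdeg hQrow hQtop using hQα
  -- (3) the kernel step: `a ⊥ ker cᵀ`, now from `hCas`
  set c : ↥T₂ → ↥T₃ → ℝ := fun α β => (Qb α).coeff β.1 with hc
  set a : ↥T₂ → ℝ := fun α => rieszFunctional y₁ (Qb α) with ha
  have hkerH : ∀ p : ↥T₂ → ℝ, (∀ β, ∑ α, p α * c α β = 0) → ∑ α, p α * a α = 0 := by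
    intro p hp
    set P : MvPolynomial (Fin n) ℝ := ∑ α, p α • monomial α.1 (1 : ℝ) with hPdef
    set Q : MvPolynomial (Fin n) ℝ := ∑ α, p α • Qb α with hQdef
    have hP : P.IsHomogeneous 2 := IsHomogeneous.sum _ _ _ fun α _ => by
      rw [smul_monomial, smul_eq_mul, mul_one]
      exact isHomogeneous_monomial _ ((hT₂ α.1).mp α.2)
    have hQ3 : Q.totalDegree ≤ 3 :=
      totalDegree_finsetSum_le fun α _ => (totalDegree_smul_le _ _).trans (hQdeg α)
    have hQrow' : ∀ u : Torus.energySpace (Fin 3), IsLevel N u →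
        Torus.nsGeneratorPairing ν f u (polyGrad b P u) = eval (fun i => Torus.pairing u.1 (b i)) Q := by
      intro u hu
      rw [hPdef, hQdef, nsGeneratorPairing_polyGrad_sum_smul ν hf hbs, map_sum]
      simp_rw [smul_eval, hQrow _ u hu]
    have hQtop' : ∀ u : Torus.energySpace (Fin 3), IsLevel N u →
        eval (fun i => Torus.pairing u.1 (b i)) (homogeneousComponent 3 Q) =
          Torus.nsGeneratorPairing (d := Fin 3) 0 0 u (polyGrad b P u) := by
      intro u hu
      have hz : Torus.IsSmooth (0 : UnitAddTorus (Fin 3) → EuclideanSpace ℝ (Fin 3)) :=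
        Torus.isSmooth_const 0
      rw [hPdef, hQdef, nsGeneratorPairing_polyGrad_sum_smul 0 hz hbs, map_sum, map_sum]
      simp_rw [LinearMap.map_smul, smul_eval, hQtop _ u hu]
    have hker : homogeneousComponent 3 Q = 0 := by
      refine MvPolynomial.ext _ _ fun β => ?_
      rw [coeff_homogeneousComponent, coeff_zero]
      split_ifs with h3
      · have h := hp ⟨β, (hT₃ β).mpr h3⟩
        simp only [hc] at h
        rw [hQdef, coeff_sum]
        simpa [coeff_smul] using h
      · rfl
    -- `P` is a Casimir on level-`N` fields: its Euler derivative is the cubic top of `Q`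
    have heuler : ∀ u : Torus.energySpace (Fin 3), IsLevel N u →
        Torus.nsGeneratorPairing (d := Fin 3) 0 0 u (polyGrad b P u) = 0 := fun u hu => by
      rw [← hQtop' u hu, hker, map_zero]
    -- `L_{y₁}(Q) = L_{y₀}(Q) = ∫ Q dμ₀ = ∫ ⟨F(u), ∇P(u)⟩ dμ₀ = 0`
    have hyy : rieszFunctional y₁ Q = rieszFunctional y₀ Q := by
      have h := rieszFunctional_sub_homogeneousComponent_congr (k := 3)
        (fun α hα => hy₁eq α (by omega)) Q hQ3
      rwa [hker, sub_zero] at h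
    have h0 : rieszFunctional y₁ Q = 0 := by
      rw [hyy, ← (hmom Q).2, ← integral_congr_ae (hl₀.mono fun u hu => hQrow' u hu)]
      exact hCas P hP heuler
    rw [hQdef, rieszFunctional_sum_smul] at h0
    exact h0
  obtain ⟨s, hs⟩ := exists_eq_sum_mul_of_forall_sum_eq_zero c a hkerH
  -- (4) the shift `S = -s` of the third moments and the inflation factor `Λ`
  set S : (Fin n →₀ ℕ) → ℝ := fun β => if h : β.degree = 3 then -(s ⟨β, (hT₃ β).mpr h⟩) else 0
    with hSdef
  obtain ⟨Λ₀, hΛ⟩ := exists_forall_le_isStrictlyKPositive_shift n y₁ S (hy₁pos 4)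
  refine ⟨y₀, fun α => if α.degree ≤ 2 then y₁ α else if α.degree = 3 then y₁ α + S α else Λ₀ * y₁ α,
    hmom, ?_, hΛ Λ₀ le_rfl, fun α hα => ?_, ?_⟩
  · simp [hy₁eq 0 (by simp), hy₀0]
  · simp [hα, hy₁eq α hα]
  -- (5) every quadratic row vanishes
  intro P hP Q hQ3 hrowQ
  set p : ↥T₂ → ℝ := fun α => P.coeff α.1 with hpdef
  have hPsum : P = ∑ α : ↥T₂, p α • monomial α.1 (1 : ℝ) :=
    eq_sum_smul_monomial_of_isHomogeneous hT₂ P hP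
  -- `Q` is the same combination of the `Q_α` (both compute the row; coordinates are onto)
  have hQQ : Q = ∑ α, p α • Qb α := by
    refine MvPolynomial.funext fun x => ?_
    obtain ⟨u, hu, hux⟩ := hlev x
    rw [← hux, ← hrowQ u hu, hPsum, nsGeneratorPairing_polyGrad_sum_smul ν hf hbs, map_sum]
    simp_rw [smul_eval, hQrow _ u hu]
  rw [hQQ, rieszFunctional_sum_smul]
  refine Finset.sum_eq_zero fun α _ => ?_
  -- `L_{y_Λ}(Q_α) = a α - Σ_β c α β s β = 0`
  have hsplit := rieszFunctional_eq_of_degree_three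
    (fun α => if α.degree ≤ 2 then y₁ α else if α.degree = 3 then y₁ α + S α else Λ₀ * y₁ α) y₁ S
    (fun β hβ => by
      have : β.degree ≤ 2 := by omega
      simp [this])
    (fun β hβ => by simp [hβ]) (Qb α) (hQdeg α)
  have hshift : ∑ β ∈ (Qb α).support, (if β.degree = 3 then (Qb α).coeff β * S β else 0) =
      -∑ β, c α β * s β := by
    rw [← Finset.sum_filter]
    -- both sides are sums over the degree-3 exponents with nonzero coefficient
    have hsub : (Qb α).support.filter (fun β => β.degree = 3) ⊆ T₃ := fun β hβ =>
      (hT₃ β).mpr (Finset.mem_filter.mp hβ).2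
    have hext : ∑ β ∈ (Qb α).support.filter (fun β => β.degree = 3), (Qb α).coeff β * S β =
        ∑ β ∈ T₃, (Qb α).coeff β * S β := by
      refine Finset.sum_subset hsub fun β hβT hβn => ?_
      have h3 : β.degree = 3 := (hT₃ β).mp hβT
      have hcoeff : (Qb α).coeff β = 0 := by
        by_contra hne
        exact hβn (Finset.mem_filter.mpr ⟨mem_support_iff.mpr hne, h3⟩)
      rw [hcoeff, zero_mul]
    rw [hext, ← Finset.sum_coe_sort T₃, ← Finset.sum_neg_distrib]
    refine Finset.sum_congr rfl fun β _ => ?_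
    obtain ⟨β, hβ⟩ := β
    have h3 : β.degree = 3 := (hT₃ β).mp hβ
    simp only [hSdef, hc, dif_pos h3]
    ring
  have haα : rieszFunctional y₁ (Qb α) = ∑ β, c α β * s β := hs α
  rw [hsplit, hshift, haα]
  ring

end Summit.AnomalousDissipation.AnomalousDissipation.Theorems.MomentParityQuarticGate
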